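/-
Origin: expansion seat `planner-pub-hodgecm-pv12-g7-0`, handover #4 2026-08-18T10:00:05Z (`HOME/pub-hodgecm-pv12-g7/lean/Pv12g7/FockPrintBridge.lean`, md5 c10fa521, 198 lines);
landed by the gen-7 packager in gate run 28 as `HodgeCM/PerL34/FockPrintBridge.lean` (import ^import Pv[0-9]+g[0-9]+\.→import HodgeCM.PerL34. ×1).
-/
/-
Copyright (c) 2026. Released under the Apache-2.0 license.
-/
import Summits.HodgeConjecture.HodgeCM.PerL34.ArchCFockAnalytic_2
import Summits.HodgeConjecture.HodgeCM.PerL34.FockPrintPlaces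

/-!
# The seam-S4 analytic Fock bridge over the PRINTED places: `w`, `w_norm`, `w_loc` discharged

Origin: expansion seat `planner-pub-hodgecm-pv12-g7-0` (unit `pub-hodgecm-pv12-g7`, DAG-node prover #12 gen 7, the
Fock-model seat; the pv12 lineage authored `ArchCFock` (gen 2) and `ArchCFockAnalytic` (gen 3/4)).  WIP module
`Pv12g7.FockPrintBridge`; intended final place `HodgeCM/PerL34/FockPrintBridge.lean` with imports
`HodgeCM.PerL34.ArchCFockAnalytic` (tree; pv12-g3, doc-revised by pv12-g5 in r25) and `HodgeCM.PerL34.FockPrintPlaces` (this seat #3, run 28; rewrite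
`^import Pv12g7\.` ↦ `import HodgeCM.PerL34.`).  Asserts nothing: no new constants, no `axiom`, complete proofs.

Node / seam: LEMMAS §9 seam **S4** = pv12-g4's `ArchC.FockAnalyticBridge C D P` (the typed input of
`FockAnalyticBridge.H_occ` = Lemma 4.1(c) and of `Open_occ_of_fockAnalyticBridges`).  Of its fields, FOUR concern the
Fock side at the real places: `pl` ([SETUP D5 + N28 local]), `w` ([SETUP D4] the archimedean type as a character of
`T(L₀⊗ℝ)`), `w_norm` ([SETUP D4] unitary), `w_loc` ([N26 / DICTIONARY] the joint vacuum character IS `w⁻¹`).  THIS FILE: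
for the PRINTED places (`Fock.PrintDict.printPlaces`, #3: place types, Adams's `λ_b`, vacuum characters
`vac_b : U(1)×U(1) →* U(1)`) these four fields are DATA + KERNEL THEOREMS (`printPlacesW`, `printPlacesW_norm`,
`printPlacesW_loc`), so the S4 input shrinks to `PrintedAnalyticSide` = the remaining fields VERBATIM (the analytic side:
[SETUP D4] `ιT`, linearity/continuity of `Φ ↦ 𝒯_Φ`, pure tensors `ins` + density, `omg_ins`; [NODE N21] `invariance`;
[SETUP D5] real directions `XR`, `ladder_span`, `hF`; [SETUP D7] Gårding data `Sm`, `YR`, `hH`; [DEFINITIONAL]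
`wOccurs_of_eigenvector`, now stated with the printed `w`).  `PrintedAnalyticSide.toBridge` rebuilds pv12-g4's bridge
(read-backs `toBridge_pl`, `toBridge_w` by `rfl`) and `PrintedAnalyticSide.H_occ` is Lemma 4.1(c) over it BY NAME.
In N26's words (PerL ll. 472–478, 485–486): the integers `e_b(Ψ_i)` are READ OFF the action of `T_b` on `φ⁰_b` — with
the printed local data that action is the kernel-computed character `vac_b(t)·(t₁t₂)^{[b = ι₁]}` (`printLoc_χ_*`), and
`w := (∏_b χ_b)⁻¹` is a unitary character of `T(L₀⊗ℝ)` with no hypothesis.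
§2 is a non-vacuity smoke: ONE real place of type `ι₁` gives `w(t) = (vac(t)·t₁t₂)⁻¹` (`printPlacesW_apply_single_iota`).

Printed inputs: those of #1–#3 ([Ad07] = Adams 2007, held `book:li2007-…`); PerL is NOT cited as a fact; every
remaining field keeps pv12-g4's label and source.
-/

set_option autoImplicit false

namespace HodgeCM
namespace PerL34
namespace ArchC

open HodgeCM.Prior.Perl34File HodgeCM.Prior.Perl34File.Perl34
open HodgeCM.PerL34.Fock HodgeCM.PerL34.Fock.PrintDict

section Printed

variable {H HG CG G SK SigIdx SigIdxG : Type*}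
variable [NormedAddCommGroup H] [InnerProductSpace ℂ H] [CompleteSpace H]
variable [NormedAddCommGroup HG] [InnerProductSpace ℂ HG] [CompleteSpace HG]
variable [NormedAddCommGroup CG] [NormedSpace ℂ CG]
variable [Group G] [TopologicalSpace G] [TopologicalSpace SK]

/-- **The S4 input over the printed places**: pv12-g4's `FockAnalyticBridge C D P` MINUS the four Fock-side fields
`pl`, `w`, `w_norm`, `w_loc` (supplied by `printPlaces` / `printPlacesW` / `printPlacesW_norm` / `printPlacesW_loc`),
every other field verbatim with `pl := printPlaces RP kind lam hlam vac` and `w := printPlacesW RP kind lam hlam vac`. -/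
structure PrintedAnalyticSide (C : IsolationCore H HG CG G SK SigIdx SigIdxG) (D : TorusData C)
    (P : C4a.PointedCore C) (RP : Type) [Fintype RP] [DecidableEq RP] (kind : RP → PlaceKind) (lam : RP → ℂ)
    (hlam : ∀ b, lam b ≠ 0) (vac : RP → (Circle × Circle →* Circle)) where
  /-- [SETUP D4] T(L₀⊗ℝ) = ∏_b T_b ⊂ U(W)(L₀⊗ℝ) ⊂ U(W)(𝔸) = `G`. -/
  ιT : (printPlaces RP kind lam hlam vac).Tg →* G
  /-- [SETUP D4] the additive group structure of 𝒮^κ. -/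
  [instSKacg : AddCommGroup SK]
  /-- [SETUP D4] the ℂ-vector-space structure of 𝒮^κ. -/
  [instSKmod : Module ℂ SK]
  /-- [SETUP D4] Φ ↦ 𝒯_Φ is additive. -/
  TΦc_add : ∀ Φ Ψ : SK, C.TΦc (Φ + Ψ) = C.TΦc Φ + C.TΦc Ψ
  /-- [SETUP D4] Φ ↦ 𝒯_Φ is homogeneous. -/
  TΦc_smul : ∀ (c : ℂ) (Φ : SK), C.TΦc (c • Φ) = c • C.TΦc Φ
  /-- [SETUP D4] Φ ↦ 𝒯_Φ(v)(g) is continuous on 𝒮^κ. -/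
  cont : ∀ (p : P.Pt) (v : H), Continuous fun Φ : SK => P.evalPt p (C.TΦc Φ v)
  /-- [SETUP D4] index of the fixed data at the other places: Φ_f ∈ 𝒮((V₃⊗W)(𝔸_f)). -/
  FinIdx : Type
  /-- [SETUP D4] the pure tensor φ ↦ φ ⊗ Φ_f ∈ 𝒮^κ, linear in φ ∈ 𝓕^κ_∞ = ⊗_b 𝓕^{κ_b}_b (printed places). -/
  ins : FinIdx → (printPlaces RP kind lam hlam vac).F →ₗ[ℂ] SK
  /-- [SETUP D4/D5] the pure tensors span a dense subspace of 𝒮^κ (Reed–Simon I Thm V.13). -/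
  dense : Dense (Submodule.span ℂ
    (Set.range fun q : FinIdx × (printPlaces RP kind lam hlam vac).F => ins q.1 q.2) : Set SK)
  /-- [SETUP D4] ω(t)(φ ⊗ Φ_f) = (ω_∞(t)φ) ⊗ Φ_f with ω_∞|_T = ⊗_b ω_{W,b}|_{T_b} (= `pl.ωT`, printed scalings). -/
  omg_ins : ∀ (f : FinIdx) (t : (printPlaces RP kind lam hlam vac).Tg) (φ : (printPlaces RP kind lam hlam vac).F),
    C.omg (ιT t) (ins f φ) = ins f ((printPlaces RP kind lam hlam vac).ωT t φ)
  /-- [NODE N21] 𝒯_{ω(h)Φ}(R(h)v) = 𝒯_Φ(v). -/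
  invariance : ∀ (h : G) (Φ : SK) (v : H), C.TΦc (C.omg h Φ) (C.R h v) = C.TΦc Φ v
  /-- [SETUP D5] index of a family of REAL directions X_j ∈ 𝔲(W)(L₀⊗ℝ). -/
  ιR : Type
  /-- [SETUP D5] ω_∞(X_j) on 𝓕^κ_∞. -/
  XR : ιR → (printPlaces RP kind lam hlam vac).F →ₗ[ℂ] (printPlaces RP kind lam hlam vac).F
  /-- [SETUP D4] the one-parameter subgroups e_j(s) = exp(sX_j). -/
  e : ιR → ℝ → G
  /-- [SETUP D4] e_j(0) = 1. -/
  he : ∀ j, e j 0 = 1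
  /-- [SETUP D5] every printed slot / ladder operator is a ℂ-combination of the real directions (Folland Prop. (4.49)). -/
  ladder_span : ∀ k : (printPlaces RP kind lam hlam vac).ιX,
    (printPlaces RP kind lam hlam vac).X k ∈ Submodule.span ℂ (Set.range XR)
  /-- [SETUP D5] derivative of s ↦ 𝒯_{ω(e_j s)(φ⊗Φ_f)}(·)(g) at 0 (Folland Thm. (4.45)). -/
  hF : ∀ (j : ιR) (f : FinIdx) (φ : (printPlaces RP kind lam hlam vac).F) (p : P.Pt),
    HasDerivAt (fun s : ℝ => C4a.pointFunctional C P (C.omg (e j s) (ins f φ)) p)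
      (C4a.pointFunctional C P (ins f (XR j φ)) p) 0
  /-- [SETUP D7] the smooth (Gårding) vectors of σ̂_i (Getz–Hahn Prop. 4.2.3). -/
  Sm : SigIdx → Set H
  /-- [SETUP D7] smooth vectors lie in σ̂_i. -/
  Sm_sub : ∀ i, Sm i ⊆ (C.hatσ i : Set H)
  /-- [SETUP D7] smooth vectors are dense in σ̂_i. -/
  Sm_dense : ∀ i, (C.hatσ i : Set H) ⊆ closure (Sm i)
  /-- [SETUP D7] the derived action dR(X_j) on smooth vectors (Getz–Hahn Lemma 4.2.2). -/
  YR : ιR → H → H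
  /-- [SETUP D7] smooth vectors are stable under dR(X_j). -/
  YR_mem : ∀ (j : ιR) (i : SigIdx), ∀ v ∈ Sm i, YR j v ∈ Sm i
  /-- [SETUP D7] s ↦ R(e_j s)v is differentiable at 0 with derivative dR(X_j)v on smooth vectors. -/
  hH : ∀ (j : ιR) (i : SigIdx), ∀ v ∈ Sm i, HasDerivAt (fun s : ℝ => C.R (e j s) v) (YR j v) 0
  /-- [DEFINITIONAL] the meaning of the frozen predicate `TorusData.wOccurs`, with the PRINTED `w`. -/
  wOccurs_of_eigenvector : ∀ i : SigIdx,
    (∃ y ∈ C.hatσ i, y ≠ 0 ∧ ∀ t : (printPlaces RP kind lam hlam vac).Tg,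
        C.R (ιT t) y = printPlacesW RP kind lam hlam vac t • y) → D.wOccurs i

namespace PrintedAnalyticSide

variable {C : IsolationCore H HG CG G SK SigIdx SigIdxG} {D : TorusData C} {P : C4a.PointedCore C}
variable {RP : Type} [Fintype RP] [DecidableEq RP] {kind : RP → PlaceKind} {lam : RP → ℂ} {hlam : ∀ b, lam b ≠ 0}
  {vac : RP → (Circle × Circle →* Circle)}

/-- **pv12-g4's S4 bridge from the printed side**: `pl := printPlaces`, `w := printPlacesW` (KERNEL `w_norm`, `w_loc`). -/
noncomputable def toBridge (A : PrintedAnalyticSide C D P RP kind lam hlam vac) : FockAnalyticBridge C D P :=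
  letI : AddCommGroup SK := A.instSKacg
  letI : Module ℂ SK := A.instSKmod
  { pl := printPlaces RP kind lam hlam vac
    ιT := A.ιT
    w := printPlacesW RP kind lam hlam vac
    w_norm := printPlacesW_norm RP kind lam hlam vac
    w_loc := printPlacesW_loc RP kind lam hlam vac
    instSKacg := A.instSKacg
    instSKmod := A.instSKmod
    TΦc_add := A.TΦc_add
    TΦc_smul := A.TΦc_smul
    cont := A.cont
    FinIdx := A.FinIdx
    ins := A.ins
    dense := A.dense
    omg_ins := A.omg_ins
    invariance := A.invariance
    ιR := A.ιR
    XR := A.XR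
    e := A.e
    he := A.he
    ladder_span := A.ladder_span
    hF := A.hF
    Sm := A.Sm
    Sm_sub := A.Sm_sub
    Sm_dense := A.Sm_dense
    YR := A.YR
    YR_mem := A.YR_mem
    hH := A.hH
    wOccurs_of_eigenvector := A.wOccurs_of_eigenvector }

/-- Read-back: the bridge's places ARE the printed places. -/
theorem toBridge_pl (A : PrintedAnalyticSide C D P RP kind lam hlam vac) :
    A.toBridge.pl = printPlaces RP kind lam hlam vac := rfl

/-- Read-back: the bridge's archimedean type character IS `(∏_b χ_b)⁻¹` of the printed places. -/
theorem toBridge_w (A : PrintedAnalyticSide C D P RP kind lam hlam vac) :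
    A.toBridge.w = printPlacesW RP kind lam hlam vac := rfl

/-- Read-back: the datum's distinguished vector IS ⊗_b φ⁰_b of the printed places
(`1 | 1 | det z` by place type). -/
theorem toBridge_toArchCDatum_φ₀ (A : PrintedAnalyticSide C D P RP kind lam hlam vac) :
    A.toBridge.toArchCDatum.φ₀ = (printPlaces RP kind lam hlam vac).φ₀ := rfl

/-- **Lemma 4.1(c) over the printed places** (pv12-g4 `FockAnalyticBridge.H_occ`, hence pv06 `ArchCDatum.H_occ`, with
`w`, `w_norm`, `w_loc` no longer inputs). -/
theorem H_occ (A : PrintedAnalyticSide C D P RP kind lam hlam vac) :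
    ∀ (Φ : SK) (i : SigIdx), (∃ v ∈ C.hatσ i, C.TΦ Φ v ≠ 0) → D.wOccurs i :=
  A.toBridge.H_occ

end PrintedAnalyticSide

end Printed

end ArchC

/-! ## §2  Smoke (non-vacuity): ONE real place, of type `ι₁` -/

namespace Fock
namespace PrintDict

/-- With a single real place of type `ι₁`, the archimedean type character of the printed places is
`w(t) = (vac(t) · t₁ t₂)⁻¹` — the vacuum character times `det`, inverted (PerL l. 485–486 "acts by the character −w_b";
l. 510 "acts by det (times the vacuum character)").  KERNEL, by `printLoc_χ_iota`. -/
theorem printPlacesW_apply_single_iota (lam : ℂ) (hlam : lam ≠ 0) (vac : Circle × Circle →* Circle)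
    (t : (printPlaces Unit (fun _ => PlaceKind.iota) (fun _ => lam) (fun _ => hlam) (fun _ => vac)).Tg) :
    printPlacesW Unit (fun _ => PlaceKind.iota) (fun _ => lam) (fun _ => hlam) (fun _ => vac) t =
      ((vac (t ()) : ℂ) * ((((t ()) : Circle × Circle).1 : ℂ) * (((t ()) : Circle × Circle).2 : ℂ)))⁻¹ := by
  show (∏ b : Unit, (printLoc lam hlam vac PlaceKind.iota).χ (t b))⁻¹ = _
  rw [Fintype.prod_unique]
  exact congrArg (·⁻¹) (printLoc_χ_iota lam hlam vac (t ()))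

end PrintDict
end Fock
end PerL34
end HodgeCM
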